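import Summits.QuantumFields.BalabanUV.Beta.D1BFx.LatticeHLSProfiles
import Summits.QuantumFields.BalabanUV.Beta.D1BFx.RankOneBubble
import Literature.MathematicalPhysics.QuantumFieldTheory.Balaban1983to89.Beta.WindowIdentification

/-!
# `BalabanUV.Beta.D1BFx.LatticeHLSPairing` — road «BF-x» for binder row D1, letter (L5) «GN-L5 HLS KIT», DOCKING FILE: the kit's profile bounds
# (`D1BFx.LatticeHLSProfiles`) stated ON THE OBJECTS OF THE RANK-ONE BUBBLE FRAME (`D1BFx.RankOneBubble`: `pairing ψ χ = Σ'_x Σ_a ψ x a·χ x a`,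
# `applyK A φ x a = Σ'_y Σ_b A x y a b·φ y b`) — `|pairing ψ χ|` and THE PROFILE OF `applyK A φ` from fibrewise profiles of the factors

HONEST FRAMING (cell contract, verbatim): «discharging `BetaPertH` makes Bałaban's UV stability UNCONDITIONAL — a real constructive-QFT
result; it is NOT the continuum limit and NOT the Clay problem.»  HONEST DEPENDENCY (verbatim): «continuum YM on T⁴ ⇐ BetaPertH ∧ nine
spine estimates (0/9 proved); BetaPertH ⇐ (D1) ∧ (D4) ∧ CAP+tail; G-an2-4 gates asym, D1 and NE2/3/4.»  THIS MODULE DISCHARGES NOTHING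
of D1 ∕ BetaPertH: it is [folklore] bookkeeping — a finite fibre sum pushed out of a lattice series — over the tree's `LatticeHLSProfiles`
(`summable_and_abs_tsum_le_of_abs_sum_le`), `LatticeHLS.sum_inv_nrm_pow_mul_le` ∕ `sum_exp_div_nrm_pow_mul_crit_le`,
`LatticeHLSRadial.sum_inv_nrm_pow_le_const` and the [our object] definitions `RankOneBubble.pairing` ∕ `applyK` (owner d1-p2-g10, p260572);
`ψ`, `χ`, `φ`, `A` below are ARBITRARY; nothing of Bałaban's is asserted; 0 binders; (K) NOT closed; NOT D1, NOT BetaPertH, NOT continuum, NOT Clay.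
WHY (owner ρ-g10-1 (N2); owner «GN-𝔅» p260572∕p260851: «each T₁∕T₂∕T₃ word is now LITERALLY a product of two `pairing`s ∕ point values `(Ga∇f)(u,κ)`
∕ leg entries … the letters (L1)–(L5) bound the factors»).  (N2)'s placements in this vocabulary: `(Ga∇ρ_u)(ξ) ≤ k n⁻²·nrm(ξ−u)⁻¹` IS
`abs_applyK_le_of_profiles` at (a,b) = (2,3) (leg entry profile `κ∕nrm(x−y)²` × gradient profile `B∕nrm(y−u)³` ⇒ profile `∝ 1∕nrm(ξ−u)` of
`applyK Ga (grad ρ_u)`), `(Ga∇δρ_u)(ξ) ≤ k n⁻²·nrm(ξ−u)⁻²` is (3,3), and a pairing `⟨∇h, Ga∇f⟩` of two profiled bond functions is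
`abs_pairing_le_of_profiles` (super-critical) ∕ `_crit` (one factor damped at scale `n`, `a+b = d`) ∕ `_bdd` (one factor summable, the other bounded).
`ExpKernelCalculus.Site D = LatticeModels.Site D = Fin D → ℤ` definitionally, so `PoissonInterior.nrm` applies to the frame's sites with no bridge.
CONTENT (all [folklore]; `C_d := d·2^{d+3}·9^{d−1}`, `κ_d := 2d·3^{d−1}`).  §1 `abs_sum_fibre_mul_le` (`|Σ_a ψ x a·χ x a| ≤ card F·(bound·bound)`);
§2 `abs_pairing_le_of_profiles` (`a, b ≤ d−1`, `a+b ≥ d+1` ⇒ summable ∧ `|pairing ψ χ| ≤ card F·κ·A·C_d∕nrm(u−v)^{a+b−d}`),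
`abs_pairing_le_of_profiles_crit` (`a+b = d`, `χ` damped ⇒ `≤ card F·κ·A·3^{d−1}(1+κ_d)(3+2∕δ+log n)`), `abs_pairing_le_of_profile_bdd`
(`|ψ| ≤ κ∕nrm(x−u)^p`, `p ≥ d+1`, `|χ| ≤ A` ⇒ `≤ card F·κ·A·(1+2κ_d)`); §3 `abs_applyK_le_of_profiles` (entry profile of the leg in `x − y`,
profile of `φ` at `u` ⇒ `|applyK A φ x c| ≤ card F·κ·B·C_d∕nrm(x−u)^{a+b−d}` at EVERY `x`, `c` — a profile again, ready for §2);
§4 the road's `(1.22)` reading at `d = 4`: `abs_fullSum_le_of_abs_sum_le` — a uniform bound `Σ_{w∈S} |K w| ≤ C` over finite `S ⊂ ℤ⁴` (the shape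
EVERY kit lemma delivers) gives convergent punctured partial sums and `|WindowIdentification.fullSum K| ≤ C` (so the kit's finite-`S` bounds ARE
bounds on the row files' `fullSum (w ↦ w_μw_ν·…)`); §5 `abs_fullSum_moment_le_of_damped_profile` — THE `(1.22)` MOMENT SUM of a damped
profile `|X w| ≤ E·e^{−(δ∕n)‖w‖∞}∕nrm(w)^p` (`p ≤ 3`): `|fullSum (w ↦ w_μw_ν·X w)| ≤ E·C(δ,p)·n^{6−p}` — the owner's announced «GN-33∕PP» step
«(1.22) sum by `LatticeHLSRadial.sum_pow_mul_exp_scale_le` (q = 2 ↦ n⁶; q = 0 ↦ n⁴)» packaged in one call (flat profile `p = 0` ↦ `n⁶`, Coulomb `p = 2` ↦ `n⁴`).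
Unit `b2b-balaban-beta-d1-formalise-leaf-04` (gen 9), offer O-d1leaf04g9-1 (i) (journal 2026-08-21 ≈l.30265).
-/

namespace Summit.QuantumFields.BalabanUV.Beta.D1BFx.LatticeHLSPairing

open Finset
open scoped BigOperators
open Literature.MathematicalPhysics.QuantumFieldTheory.Balaban1983to89.Beta
open ExpKernelCalculus (Site MKer)
open PoissonInterior (supNorm nrm nrm_pos nrm_neg)
open LatticeHLSRadial (sum_inv_nrm_pow_le_const)
open LatticeHLS (sum_inv_nrm_pow_mul_le sum_exp_div_nrm_pow_mul_crit_le)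
open LatticeHLSProfiles (summable_and_abs_tsum_le_of_abs_sum_le)
open RankOneBubble (pairing applyK pairing_def applyK_apply)

variable {d : ℕ} {F : Type*} [Fintype F]

/-! ## §1 The finite fibre sum -/

/-- [folklore] **FIBREWISE PRODUCT**: if `|ψ x a| ≤ P` and `|χ x a| ≤ Q` for every fibre index `a` (`P ≥ 0`) then
`|Σ_a ψ x a·χ x a| ≤ card F·(P·Q)`. -/
theorem abs_sum_fibre_mul_le {ψ χ : Site d → F → ℝ} {P Q : ℝ} (hP : 0 ≤ P) (x : Site d) (hψ : ∀ a, |ψ x a| ≤ P)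
    (hχ : ∀ a, |χ x a| ≤ Q) : |∑ a, ψ x a * χ x a| ≤ Fintype.card F * (P * Q) := by
  calc |∑ a, ψ x a * χ x a| ≤ ∑ a, |ψ x a * χ x a| := Finset.abs_sum_le_sum_abs _ _
    _ ≤ ∑ _a : F, P * Q := Finset.sum_le_sum fun a _ => by
        rw [abs_mul]; exact mul_le_mul (hψ a) (hχ a) (abs_nonneg _) hP
    _ = Fintype.card F * (P * Q) := by rw [Finset.sum_const, nsmul_eq_mul, Finset.card_univ]

/-! ## §2 `|pairing ψ χ|` from fibrewise profiles -/

/-- [folklore] **PAIRING OF TWO PROFILED BOND FUNCTIONS, SUPER-CRITICAL** (`a, b ≤ d−1`, `a+b ≥ d+1`; `κ, A ≥ 0`): fibrewise profiles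
`|ψ x c| ≤ κ∕nrm(x−u)^a`, `|χ x c| ≤ A∕nrm(x−v)^b` ⇒ the fibre-summed product is summable and
`|pairing ψ χ| ≤ card F·κ·A·(d·2^{d+3}·9^{d−1})∕nrm(u−v)^{a+b−d}`. -/
theorem abs_pairing_le_of_profiles (hd : 0 < d) {a b : ℕ} (ha : a ≤ d - 1) (hb : b ≤ d - 1) (hab : d + 1 ≤ a + b)
    {ψ χ : Site d → F → ℝ} {κ A : ℝ} (hκ : 0 ≤ κ) (hA : 0 ≤ A) (u v : Site d)
    (hψ : ∀ x c, |ψ x c| ≤ κ / nrm (x - u) ^ a) (hχ : ∀ x c, |χ x c| ≤ A / nrm (x - v) ^ b) :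
    Summable (fun x => ∑ c, ψ x c * χ x c) ∧
      |pairing ψ χ| ≤ Fintype.card F * κ * A * (d * 2 ^ (d + 3) * 9 ^ (d - 1)) / nrm (u - v) ^ (a + b - d) := by
  have hpt : ∀ x, |∑ c, ψ x c * χ x c| ≤ Fintype.card F * κ * A * (1 / (nrm (x - u) ^ a * nrm (x - v) ^ b)) := by
    intro x
    have := nrm_pos (x - u); have := nrm_pos (x - v)
    refine le_trans (abs_sum_fibre_mul_le (by positivity) x (hψ x) (hχ x)) (le_of_eq ?_)
    rw [div_mul_div_comm, mul_one_div]; ring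
  have hS : ∀ S : Finset (Site d), ∑ x ∈ S, |∑ c, ψ x c * χ x c|
      ≤ Fintype.card F * κ * A * (d * 2 ^ (d + 3) * 9 ^ (d - 1)) / nrm (u - v) ^ (a + b - d) := by
    intro S
    calc ∑ x ∈ S, |∑ c, ψ x c * χ x c| ≤ ∑ x ∈ S, Fintype.card F * κ * A * (1 / (nrm (x - u) ^ a * nrm (x - v) ^ b)) :=
          Finset.sum_le_sum fun x _ => hpt x
      _ = Fintype.card F * κ * A * ∑ x ∈ S, 1 / (nrm (x - u) ^ a * nrm (x - v) ^ b) := by rw [Finset.mul_sum]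
      _ ≤ Fintype.card F * κ * A * (d * 2 ^ (d + 3) * 9 ^ (d - 1) / nrm (u - v) ^ (a + b - d)) :=
          mul_le_mul_of_nonneg_left (sum_inv_nrm_pow_mul_le hd ha hb hab S u v) (by positivity)
      _ = _ := by ring
  have h := summable_and_abs_tsum_le_of_abs_sum_le hS
  exact ⟨h.1, by rw [pairing_def]; exact h.2⟩

/-- [folklore] **PAIRING, CRITICAL, ONE FACTOR DAMPED AT SCALE `n`** (`a, b ≤ d−1`, `a+b = d`, `n ≥ 1`): `|ψ x c| ≤ κ∕nrm(x−u)^a`,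
`|χ x c| ≤ A·e^{−(δ∕n)‖x−v‖∞}∕nrm(x−v)^b` ⇒ summable and `|pairing ψ χ| ≤ card F·κ·A·3^{d−1}(1+2d·3^{d−1})(3+2∕δ+log n)`. -/
theorem abs_pairing_le_of_profiles_crit (hd : 0 < d) {a b : ℕ} (ha : a ≤ d - 1) (hb : b ≤ d - 1) (hab : a + b = d)
    {δ : ℝ} (hδ : 0 < δ) {n : ℕ} (hn : 1 ≤ n) {ψ χ : Site d → F → ℝ} {κ A : ℝ} (hκ : 0 ≤ κ) (hA : 0 ≤ A) (u v : Site d)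
    (hψ : ∀ x c, |ψ x c| ≤ κ / nrm (x - u) ^ a) (hχ : ∀ x c, |χ x c| ≤ A * Real.exp (-(δ / n) * supNorm (x - v)) / nrm (x - v) ^ b) :
    Summable (fun x => ∑ c, ψ x c * χ x c) ∧
      |pairing ψ χ| ≤ Fintype.card F * κ * A * (3 ^ (d - 1) * (1 + 2 * d * 3 ^ (d - 1)) * (3 + 2 / δ + Real.log n)) := by
  have hpt : ∀ x, |∑ c, ψ x c * χ x c|
      ≤ Fintype.card F * κ * A * (Real.exp (-(δ / n) * supNorm (x - v)) / (nrm (x - u) ^ a * nrm (x - v) ^ b)) := by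
    intro x
    have := nrm_pos (x - u); have := nrm_pos (x - v)
    refine le_trans (abs_sum_fibre_mul_le (by positivity) x (hψ x) (hχ x)) (le_of_eq ?_)
    rw [div_mul_div_comm]; ring
  have hS : ∀ S : Finset (Site d), ∑ x ∈ S, |∑ c, ψ x c * χ x c|
      ≤ Fintype.card F * κ * A * (3 ^ (d - 1) * (1 + 2 * d * 3 ^ (d - 1)) * (3 + 2 / δ + Real.log n)) := by
    intro S
    calc ∑ x ∈ S, |∑ c, ψ x c * χ x c|
        ≤ ∑ x ∈ S, Fintype.card F * κ * A * (Real.exp (-(δ / n) * supNorm (x - v)) / (nrm (x - u) ^ a * nrm (x - v) ^ b)) :=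
          Finset.sum_le_sum fun x _ => hpt x
      _ = Fintype.card F * κ * A * ∑ x ∈ S, Real.exp (-(δ / n) * supNorm (x - v)) / (nrm (x - u) ^ a * nrm (x - v) ^ b) := by
          rw [Finset.mul_sum]
      _ ≤ _ := mul_le_mul_of_nonneg_left (sum_exp_div_nrm_pow_mul_crit_le hd ha hb hab hδ hn S u v) (by positivity)
  have h := summable_and_abs_tsum_le_of_abs_sum_le hS
  exact ⟨h.1, by rw [pairing_def]; exact h.2⟩

/-- [folklore] **PAIRING, ONE FACTOR SUMMABLE, THE OTHER BOUNDED** (`p ≥ d+1`; `κ ≥ 0`): `|ψ x c| ≤ κ∕nrm(x−u)^p`, `|χ x c| ≤ A` ⇒ summable and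
`|pairing ψ χ| ≤ card F·κ·A·(1 + 4d·3^{d−1})`. -/
theorem abs_pairing_le_of_profile_bdd (hd : 0 < d) {p : ℕ} (hp : d + 1 ≤ p) {ψ χ : Site d → F → ℝ} {κ A : ℝ} (hκ : 0 ≤ κ) (u : Site d)
    (hψ : ∀ x c, |ψ x c| ≤ κ / nrm (x - u) ^ p) (hχ : ∀ x c, |χ x c| ≤ A) :
    Summable (fun x => ∑ c, ψ x c * χ x c) ∧ |pairing ψ χ| ≤ Fintype.card F * κ * A * (1 + 4 * d * 3 ^ (d - 1)) := by
  by_cases hF : Fintype.card F = 0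
  · haveI : IsEmpty F := Fintype.card_eq_zero_iff.mp hF
    have h0 : (fun x : Site d => ∑ c, ψ x c * χ x c) = fun _ => 0 := by funext x; simp
    refine ⟨by rw [h0]; exact summable_zero, ?_⟩
    rw [pairing_def, h0, tsum_zero, hF, abs_zero]; simp
  have hA : 0 ≤ A := by
    obtain ⟨c⟩ := Fintype.card_pos_iff.mp (Nat.pos_of_ne_zero hF)
    exact le_trans (abs_nonneg _) (hχ u c)
  have hpt : ∀ x, |∑ c, ψ x c * χ x c| ≤ Fintype.card F * κ * A * (1 / nrm (x - u) ^ p) := by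
    intro x
    have := nrm_pos (x - u)
    refine le_trans (abs_sum_fibre_mul_le (by positivity) x (hψ x) (hχ x)) (le_of_eq ?_)
    rw [mul_one_div]; ring
  have hS : ∀ S : Finset (Site d), ∑ x ∈ S, |∑ c, ψ x c * χ x c| ≤ Fintype.card F * κ * A * (1 + 4 * d * 3 ^ (d - 1)) := by
    intro S
    calc ∑ x ∈ S, |∑ c, ψ x c * χ x c| ≤ ∑ x ∈ S, Fintype.card F * κ * A * (1 / nrm (x - u) ^ p) := Finset.sum_le_sum fun x _ => hpt x
      _ = Fintype.card F * κ * A * ∑ x ∈ S, 1 / nrm (x - u) ^ p := by rw [Finset.mul_sum]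
      _ ≤ _ := mul_le_mul_of_nonneg_left (sum_inv_nrm_pow_le_const hd hp S u) (by positivity)
  have h := summable_and_abs_tsum_le_of_abs_sum_le hS
  exact ⟨h.1, by rw [pairing_def]; exact h.2⟩

/-! ## §3 The profile of `applyK A φ` (profile in, profile out) -/

/-- [folklore] **A LEG ACTING ON A PROFILED BOND FUNCTION IS PROFILED** (`a, b ≤ d−1`, `a+b ≥ d+1`; `κ, B ≥ 0`): a translation-covariant entry
profile of the leg `|A x y c e| ≤ κ∕nrm(x−y)^a` and a profile `|φ y e| ≤ B∕nrm(y−u)^b` give, at EVERY `x`, `c`,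
`|applyK A φ x c| ≤ card F·κ·B·(d·2^{d+3}·9^{d−1})∕nrm(x−u)^{a+b−d}` — e.g. `(Ga∇ρ_u)(ξ) ≤ k n⁻²·nrm(ξ−u)⁻¹` ((a,b) = (2,3), d = 4) and
`(Ga∇δρ_u)(ξ) ≤ k n⁻²·nrm(ξ−u)⁻²` ((3,3)) of the T₃ ledger; the output is again a §2-profile (centre `u`, exponent `a+b−d`). -/
theorem abs_applyK_le_of_profiles (hd : 0 < d) {a b : ℕ} (ha : a ≤ d - 1) (hb : b ≤ d - 1) (hab : d + 1 ≤ a + b)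
    {A : MKer d F} {φ : Site d → F → ℝ} {κ B : ℝ} (hκ : 0 ≤ κ) (hB : 0 ≤ B) (u : Site d)
    (hA : ∀ x y c e, |A x y c e| ≤ κ / nrm (x - y) ^ a) (hφ : ∀ y e, |φ y e| ≤ B / nrm (y - u) ^ b) (x : Site d) (c : F) :
    |applyK A φ x c| ≤ Fintype.card F * κ * B * (d * 2 ^ (d + 3) * 9 ^ (d - 1)) / nrm (x - u) ^ (a + b - d) := by
  -- `applyK A φ x c = pairing (fun y e => A x y c e) φ`, a pairing of two profiled bond functions with centres `x` and `u`
  have e : applyK A φ x c = pairing (fun y e => A x y c e) φ := by rw [applyK_apply, pairing_def]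
  rw [e]
  refine (abs_pairing_le_of_profiles hd ha hb hab hκ hB x u (fun y e => ?_) hφ).2
  rw [← nrm_neg, neg_sub]
  exact hA x y c e

/-- [folklore] **LEG × DAMPED PROFILE, CRITICAL** (`a, b ≤ d−1`, `a+b = d`, `n ≥ 1`): `|A x y c e| ≤ κ∕nrm(x−y)^a`,
`|φ y e| ≤ B·e^{−(δ∕n)‖y−u‖∞}∕nrm(y−u)^b` ⇒ `|applyK A φ x c| ≤ card F·κ·B·3^{d−1}(1+2d·3^{d−1})(3+2∕δ+log n)` at every `x`, `c`. -/
theorem abs_applyK_le_of_profiles_crit (hd : 0 < d) {a b : ℕ} (ha : a ≤ d - 1) (hb : b ≤ d - 1) (hab : a + b = d)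
    {δ : ℝ} (hδ : 0 < δ) {n : ℕ} (hn : 1 ≤ n) {A : MKer d F} {φ : Site d → F → ℝ} {κ B : ℝ} (hκ : 0 ≤ κ) (hB : 0 ≤ B) (u : Site d)
    (hA : ∀ x y c e, |A x y c e| ≤ κ / nrm (x - y) ^ a)
    (hφ : ∀ y e, |φ y e| ≤ B * Real.exp (-(δ / n) * supNorm (y - u)) / nrm (y - u) ^ b) (x : Site d) (c : F) :
    |applyK A φ x c| ≤ Fintype.card F * κ * B * (3 ^ (d - 1) * (1 + 2 * d * 3 ^ (d - 1)) * (3 + 2 / δ + Real.log n)) := by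
  have e : applyK A φ x c = pairing (fun y e => A x y c e) φ := by rw [applyK_apply, pairing_def]
  rw [e]
  refine (abs_pairing_le_of_profiles_crit hd ha hb hab hδ hn hκ hB x u (fun y e => ?_) hφ).2
  rw [← nrm_neg, neg_sub]
  exact hA x y c e

/-! ## §4 The road's `fullSum` reading (`d = 4`) -/

/-- [folklore] **UNIFORM FINITE-SET BOUND ⇒ `fullSum` BOUND** (`d = 4`, the road's `(1.22)` currency `WindowIdentification.fullSum K =
lim_R Σ_{0<‖w‖∞≤R} K w`): if `Σ_{w∈S} |K w| ≤ C` for every finite `S ⊂ ℤ⁴` then the punctured partial sums converge and `|fullSum K| ≤ C`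
(summability from `summable_of_sum_le`, the limit by `tendsto_psum_of_summable`, the bound shellwise). -/
theorem abs_fullSum_le_of_abs_sum_le {K : DyadicShell.Pt → ℝ} {C : ℝ} (h : ∀ S : Finset DyadicShell.Pt, ∑ w ∈ S, |K w| ≤ C) :
    (∃ B, Filter.Tendsto (WindowIdentification.psum K) Filter.atTop (nhds B)) ∧ |WindowIdentification.fullSum K| ≤ C := by
  have hs : Summable K := (summable_of_sum_le (fun w => abs_nonneg (K w)) h).of_abs
  have ht := WindowIdentification.tendsto_psum_of_summable K hs
  refine ⟨⟨_, ht⟩, ?_⟩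
  rw [WindowIdentification.fullSum_eq_tsum_sub K hs]
  refine le_of_tendsto' ht.abs fun R => ?_
  rw [WindowIdentification.psum_def]
  exact (Finset.abs_sum_le_sum_abs _ _).trans (h _)

/-! ## §5 The `(1.22)` moment sum of a damped profile (`d = 4`) -/

/-- [folklore] **THE `(1.22)` WINDOW SUM OF A DAMPED PROFILE** (`d = 4`, `n ≥ 1`, `p ≤ 3`): if `|X w| ≤ E·e^{−(δ∕n)‖w‖∞}∕nrm(w)^p` at every
`w ∈ ℤ⁴` then the moment-weighted punctured lattice sum converges and
`|fullSum (w ↦ w_μ·w_ν·X w)| ≤ E·(2·2!·(2∕δ)²·(1 + 2·4·3³·((3−p)!·(4∕δ)^{3−p}·(1+4∕δ))))·n^{6−p}` — `n⁶` for a flat profile (`p = 0`, e.g.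
`k n⁻⁶·e^{−δ‖w‖∕n}`), `n⁴` for a Coulomb profile (`p = 2`, e.g. `k n⁻⁴·e^{…}∕‖w‖²`): the two saturated sums of the owner's «GN-33∕PP» plan and of
an3 §3′ (4) (`|w_μw_ν| ≤ ‖w‖∞²` by `BubbleTransfer.abs_moment_le`, then part 3's `sum_pow_mul_exp_div_nrm_pow_free_scale_le` at `q = 2`, `u = v = 0`,
then §4). -/
theorem abs_fullSum_moment_le_of_damped_profile {X : DyadicShell.Pt → ℝ} {E δ : ℝ} (hE : 0 ≤ E) (hδ : 0 < δ) {n : ℕ} (hn : 1 ≤ n)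
    {p : ℕ} (hp : p ≤ 3) (hX : ∀ w, |X w| ≤ E * Real.exp (-(δ / n) * DyadicShell.supNorm w) / nrm (d := 4) w ^ p) (μ ν : Fin 4) :
    (∃ B, Filter.Tendsto (WindowIdentification.psum (fun w => DyadicShell.toReal w μ * DyadicShell.toReal w ν * X w)) Filter.atTop (nhds B)) ∧
      |WindowIdentification.fullSum (fun w => DyadicShell.toReal w μ * DyadicShell.toReal w ν * X w)|
        ≤ E * (2 * (2 : ℕ).factorial * (2 / δ) ^ 2 * (1 + 2 * (4 : ℕ) * 3 ^ (4 - 1) * ((4 - 1 - p).factorial * (4 / δ) ^ (4 - 1 - p) * (1 + 4 / δ))))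
          * (n : ℝ) ^ (4 - p + 2) := by
  refine abs_fullSum_le_of_abs_sum_le fun S => ?_
  have hpt : ∀ w : DyadicShell.Pt, |DyadicShell.toReal w μ * DyadicShell.toReal w ν * X w|
      ≤ E * (((supNorm (d := 4) (w - 0) : ℕ) : ℝ) ^ 2 * Real.exp (-(δ / n) * supNorm (d := 4) (w - 0)) / nrm (d := 4) (w - 0) ^ p) := by
    intro w
    have h1 := BubbleTransfer.abs_moment_le μ ν w
    have h2 := hX w
    have h3 := nrm_pos (d := 4) w
    rw [sub_zero, abs_mul, ← LatticeHLSProfiles.supNorm_dyadic]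
    calc |DyadicShell.toReal w μ * DyadicShell.toReal w ν| * |X w|
        ≤ (DyadicShell.supNorm w : ℝ) ^ 2 * (E * Real.exp (-(δ / n) * DyadicShell.supNorm w) / nrm (d := 4) w ^ p) :=
          mul_le_mul h1 h2 (abs_nonneg _) (by positivity)
      _ = _ := by ring
  calc ∑ w ∈ S, |DyadicShell.toReal w μ * DyadicShell.toReal w ν * X w|
      ≤ ∑ w ∈ S, E * (((supNorm (d := 4) (w - 0) : ℕ) : ℝ) ^ 2 * Real.exp (-(δ / n) * supNorm (d := 4) (w - 0)) / nrm (d := 4) (w - 0) ^ p) :=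
        Finset.sum_le_sum fun w _ => hpt w
    _ = E * ∑ w ∈ S, ((supNorm (d := 4) (w - 0) : ℕ) : ℝ) ^ 2 * Real.exp (-(δ / n) * supNorm (d := 4) (w - 0)) / nrm (d := 4) (w - 0) ^ p := by
        rw [Finset.mul_sum]
    _ ≤ _ := mul_le_mul_of_nonneg_left
        (LatticeHLSProfiles.sum_pow_mul_exp_div_nrm_pow_free_scale_le (d := 4) (by norm_num) hδ hn (by omega) 2 S 0 0) hE
    _ = _ := by ring

end Summit.QuantumFields.BalabanUV.Beta.D1BFx.LatticeHLSPairing
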